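import Summits.CriticalPhenomena.PercolationContinuityZ3.Theorems.PercNearOneGluingNoHeavyLowerTailAntipodalR1PocketBijection
import Summits.CriticalPhenomena.PercolationContinuityZ3.Theorems.PercNearOneGluingNoHeavyLowerTailAntipodalR1Irreducible
import HarnessLib

/-!
# The pocket flip, V: R1 for every `q > 0` from the multiply attached residue on irreducible instances

Support file for `stmt-CriticalPhenomena-4575` (memo `prim-gen-kcluster/KCLUSTER-gen79.md` §1).  No definitions,
no named facts, no sorries.  Composition of part III's reduction (`AntipodalR1.card_lSet_grade_le_of_residual`)
with gen 78's decomposition induction (`AntipodalR1.card_lSet_grade_le_of_irreducible`) and LEMMA F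
(`AntipodalR1.r1_rc_of_irreducible_graded_anti1`):

* `AntipodalR1.card_lSet_grade_le_of_irreducible_residual` — if on every IRREDUCIBLE instance
  (`a, b, c` distinct and met, no 1-sum, no terminal-free 2-separation side with ≥ 2 edges) the level inequality
  holds between the MULTIPLY ATTACHED elements of `L` and of `R(b,c)` (hypothesis `Hres`, the residue of part III
  spelled out), then ANTI₁-GRADED holds for every finite edge system on `V`;
* `AntipodalR1.r1_rc_of_irreducible_residual` — hence the refined row R1
  `φ(T)·φ(S_a) ≤ φ(U_b)·φ(U_c)` for `φ = rcMeasureW w q ∅`, EVERY `q > 0`, every weight vector supported in `D₀`.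
So the remaining hypothesis of the whole chain is `Hres`: per level, on irreducible instances,
`#{x ∈ L : pocket of c multiply attached, g = t} ≤ #{y ∈ R(b,c) : pocket of c (avoiding O_a) multiply attached, g = t}`.
[this work]
-/

namespace Summit.CriticalPhenomena.PercolationContinuityZ3.Theorems

namespace AntipodalR1

open Finset Relation SimpleGraph

universe u₀

variable {V : Type u₀} [Fintype V] [DecidableEq V]

open Classical in
/-- **ANTI₁-GRADED from the multiply attached residue on irreducible instances.** [this work] -/
theorem card_lSet_grade_le_of_irreducible_residual
    (Hres : ∀ (ι : Type u₀) [Fintype ι] [DecidableEq ι] (ends : ι → Sym2 V) (a b c : V),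
      a ≠ b → a ≠ c → b ≠ c → (∃ i, a ∈ ends i) → (∃ i, b ∈ ends i) → (∃ i, c ∈ ends i) →
      (¬ ∃ (S : Finset ι) (h : V), S.Nonempty ∧ Sᶜ.Nonempty ∧
          ∀ w, (∃ i ∈ S, w ∈ ends i) → (∃ j ∉ S, w ∈ ends j) → w = h) →
      (¬ ∃ (S : Finset ι) (u v : V), u ≠ v ∧ 2 ≤ S.card ∧ Sᶜ.Nonempty ∧
          (∀ w, (∃ i ∈ S, w ∈ ends i) → (∃ j ∉ S, w ∈ ends j) → w = u ∨ w = v) ∧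
          (∀ j ∈ S, a ∈ ends j → a = u ∨ a = v) ∧ (∀ j ∈ S, b ∈ ends j → b = u ∨ b = v) ∧
          (∀ j ∈ S, c ∈ ends j → c = u ∨ c = v)) →
      ∀ t : ℕ,
      ((lSet ends a b c).filter fun x =>
        (¬ ∀ w, w ∉ region ends x a c → (∃ e u, ends e = s(w, u) ∧ u ∈ region ends x a c) →
          ReflTransGen (fun u w => w ∈ nbr ends x true u ∧
            u ∉ region ends x a c ∧ w ∉ region ends x a c) a w) ∧
        Nat.card (fromEdgeSet {s : Sym2 V | ∃ e, x e = true ∧ ends e = s}).ConnectedComponent +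
          Nat.card (fromEdgeSet {s : Sym2 V | ∃ e, x e = false ∧ ends e = s}).ConnectedComponent = t).card ≤
      ((rSet ends a b c).filter fun y =>
        (¬ ∀ w, w ∉ region ends (fun i => !y i) a c →
          (∃ e u, ends e = s(w, u) ∧ u ∈ region ends (fun i => !y i) a c) →
          ReflTransGen (fun u w => w ∈ nbr ends y false u ∧
            u ∉ region ends (fun i => !y i) a c ∧ w ∉ region ends (fun i => !y i) a c) a w) ∧
        Nat.card (fromEdgeSet {s : Sym2 V | ∃ e, y e = true ∧ ends e = s}).ConnectedComponent +
          Nat.card (fromEdgeSet {s : Sym2 V | ∃ e, y e = false ∧ ends e = s}).ConnectedComponent = t).card)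
    {ι : Type u₀} [Fintype ι] [DecidableEq ι] (ends : ι → Sym2 V) (a b c : V) (t : ℕ) :
    (univ.filter fun x : ι → Bool => x ∈ lSet ends a b c ∧
        (Nat.card (fromEdgeSet {s : Sym2 V | ∃ i, x i = true ∧ ends i = s}).ConnectedComponent +
        Nat.card (fromEdgeSet {s : Sym2 V | ∃ i, x i = false ∧ ends i = s}).ConnectedComponent) =
          t).card ≤
      (univ.filter fun x : ι → Bool => x ∈ rSet ends a b c ∧
        (Nat.card (fromEdgeSet {s : Sym2 V | ∃ i, x i = true ∧ ends i = s}).ConnectedComponent +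
        Nat.card (fromEdgeSet {s : Sym2 V | ∃ i, x i = false ∧ ends i = s}).ConnectedComponent) =
          t).card := by
  refine card_lSet_grade_le_of_irreducible ?_ ends a b c t
  intro κ _ _ ends' a' b' c' hab hac hbc hma hmb hmc h1 h2 t'
  have hres' := Hres κ ends' a' b' c' hab hac hbc hma hmb hmc h1 h2
  have key := card_lSet_grade_le_of_residual ends' a' b' c' (fun s => by convert hres' s using 3) t'
  have eL : (univ.filter fun x : κ → Bool => x ∈ lSet ends' a' b' c' ∧
      (Nat.card (fromEdgeSet {s : Sym2 V | ∃ i, x i = true ∧ ends' i = s}).ConnectedComponent +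
      Nat.card (fromEdgeSet {s : Sym2 V | ∃ i, x i = false ∧ ends' i = s}).ConnectedComponent) = t') =
      (lSet ends' a' b' c').filter fun x =>
        Nat.card (fromEdgeSet {s : Sym2 V | ∃ e, x e = true ∧ ends' e = s}).ConnectedComponent +
          Nat.card (fromEdgeSet {s : Sym2 V | ∃ e, x e = false ∧ ends' e = s}).ConnectedComponent = t' := by
    ext x; simp only [Finset.mem_filter, Finset.mem_univ, true_and]
  have eR : (univ.filter fun x : κ → Bool => x ∈ rSet ends' a' b' c' ∧
      (Nat.card (fromEdgeSet {s : Sym2 V | ∃ i, x i = true ∧ ends' i = s}).ConnectedComponent +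
      Nat.card (fromEdgeSet {s : Sym2 V | ∃ i, x i = false ∧ ends' i = s}).ConnectedComponent) = t') =
      (rSet ends' a' b' c').filter fun x =>
        Nat.card (fromEdgeSet {s : Sym2 V | ∃ e, x e = true ∧ ends' e = s}).ConnectedComponent +
          Nat.card (fromEdgeSet {s : Sym2 V | ∃ e, x e = false ∧ ends' e = s}).ConnectedComponent = t' := by
    ext x; simp only [Finset.mem_filter, Finset.mem_univ, true_and]
  rw [eL, eR]
  convert key using 3

open Classical in
open Literature.Probability.Percolation (BondConfig) in
open Literature.Probability.Percolation.Gladkov (cl) in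
open Literature.Probability.LatticeModels (rcMeasureW) in
open RefinedRowR3 (Sep) in
/-- **R1 for every `q > 0` from the multiply attached residue on irreducible instances**: the refined row
`φ(T)·φ(S_a) ≤ φ(U_b)·φ(U_c)` for `φ = rcMeasureW w q ∅`, weights supported in `D₀`. [this work] -/
theorem r1_rc_of_irreducible_residual
    (Hres : ∀ (ι : Type u₀) [Fintype ι] [DecidableEq ι] (ends : ι → Sym2 V) (a b c : V),
      a ≠ b → a ≠ c → b ≠ c → (∃ i, a ∈ ends i) → (∃ i, b ∈ ends i) → (∃ i, c ∈ ends i) →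
      (¬ ∃ (S : Finset ι) (h : V), S.Nonempty ∧ Sᶜ.Nonempty ∧
          ∀ w, (∃ i ∈ S, w ∈ ends i) → (∃ j ∉ S, w ∈ ends j) → w = h) →
      (¬ ∃ (S : Finset ι) (u v : V), u ≠ v ∧ 2 ≤ S.card ∧ Sᶜ.Nonempty ∧
          (∀ w, (∃ i ∈ S, w ∈ ends i) → (∃ j ∉ S, w ∈ ends j) → w = u ∨ w = v) ∧
          (∀ j ∈ S, a ∈ ends j → a = u ∨ a = v) ∧ (∀ j ∈ S, b ∈ ends j → b = u ∨ b = v) ∧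
          (∀ j ∈ S, c ∈ ends j → c = u ∨ c = v)) →
      ∀ t : ℕ,
      ((lSet ends a b c).filter fun x =>
        (¬ ∀ w, w ∉ region ends x a c → (∃ e u, ends e = s(w, u) ∧ u ∈ region ends x a c) →
          ReflTransGen (fun u w => w ∈ nbr ends x true u ∧
            u ∉ region ends x a c ∧ w ∉ region ends x a c) a w) ∧
        Nat.card (fromEdgeSet {s : Sym2 V | ∃ e, x e = true ∧ ends e = s}).ConnectedComponent +
          Nat.card (fromEdgeSet {s : Sym2 V | ∃ e, x e = false ∧ ends e = s}).ConnectedComponent = t).card ≤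
      ((rSet ends a b c).filter fun y =>
        (¬ ∀ w, w ∉ region ends (fun i => !y i) a c →
          (∃ e u, ends e = s(w, u) ∧ u ∈ region ends (fun i => !y i) a c) →
          ReflTransGen (fun u w => w ∈ nbr ends y false u ∧
            u ∉ region ends (fun i => !y i) a c ∧ w ∉ region ends (fun i => !y i) a c) a w) ∧
        Nat.card (fromEdgeSet {s : Sym2 V | ∃ e, y e = true ∧ ends e = s}).ConnectedComponent +
          Nat.card (fromEdgeSet {s : Sym2 V | ∃ e, y e = false ∧ ends e = s}).ConnectedComponent = t).card)
    (w : Sym2 V → unitInterval) {q : ℝ} (hq : 0 < q) (D₀ : Finset (Sym2 V))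
    (hw : ∀ e, e ∉ D₀ → (w e : ℝ) = 0) (a b c : V) :
    (rcMeasureW w q ∅).real {η : BondConfig V | b ∈ cl η.toFinset a ∧ c ∈ cl η.toFinset a} *
        (rcMeasureW w q ∅).real {η : BondConfig V | b ∉ cl η.toFinset a ∧ c ∉ cl η.toFinset a ∧
          Sep D₀ (cl η.toFinset a) b c} ≤
      (rcMeasureW w q ∅).real {η : BondConfig V | b ∈ cl η.toFinset a ∧ c ∉ cl η.toFinset a} *
        (rcMeasureW w q ∅).real {η : BondConfig V | b ∉ cl η.toFinset a ∧ c ∈ cl η.toFinset a} :=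
  r1_rc_of_graded_anti1 (fun _ ends' a b c t => card_lSet_grade_le_of_irreducible_residual Hres ends' a b c t)
    w hq D₀ hw a b c

end AntipodalR1

end Summit.CriticalPhenomena.PercolationContinuityZ3.Theorems
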